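import Literature.Computability.Complexity.ConstantDepth
import HarnessLib

/-!
# Grewal–Kumar's `G(k)` gates and the basis of `GC⁰(k)[p]`

The gate class behind the circuit classes `GC⁰(k)`, `GC⁰(k)[p]` of Grewal–Kumar 2024 (after
Kumar 2023): a `G(k)` gate is an unbounded fan-in gate which "computes within a Hamming ball of
radius `k`" — the designer chooses a centre `c` and an arbitrary truth table on the ball
`B_{k,c}`, and OUTSIDE the ball the gate outputs a constant (Grewal–Kumar 2024, §2.1). `AND`,
`OR`, `NOT` are `G(0)` gates; every gate of fan-in `≤ k` is a `G(k)` gate.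

* `ballGates k` — the set of `G(k)` gate functions (all arities);
* `gcBasis k p = {¬} ∪ {MOD_{p,m} | m} ∪ ballGates k` — the basis of `GC⁰(k)[p]` circuits
  (`G(k)` gates together with `MOD_p` gates of every arity; negation listed explicitly so that
  `acWeight`-depth keeps negations free);
* API: monotonicity in `k`, `∧ₘ, ∨ₘ, ¬ ∈ ballGates k`, small fan-in gates are ball gates,
  `acBasis ⊆ accBasis p ⊆ gcBasis k p`.

The Razborov–Smolensky approximation lemma for circuits over `gcBasis k p` (Grewal–Kumar 2024,
Thm. 3.8, in product form) is `Literature.Computability.MetaComplexity.Smolensky.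
razborov_smolensky_ball` (`MetaComplexity/RazborovSmolenskyBallApprox.lean`).

Deliberately NOT here: the language classes `GC⁰(k)`, `GC⁰(k)[p]` as `Set (Language Bool)`
(use `DepthSizeClass (gcBasis k p) d s` from `ConstantDepth.lean` when needed); switching
lemmas for `G(k)` gates (Kumar 2023; Grewal–Kumar 2024 §4).

## References

* S. Grewal, V. M. Kumar, *Improved circuit lower bounds and quantum-classical separations*,
  arXiv:2408.16406 (2024), §2.1 "The `G(k)` gate" [GrewalKumar2024].
-/

namespace Literature.Computability.Complexity

open Finset

/-! ### `G(k)` gates -/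

/-- **Grewal–Kumar's `G(k)` gates** (arXiv:2408.16406 §2.1): a gate function `g` (of any arity)
is a `G(k)` gate if for some centre `c` and some constant `b` it outputs `b` on every input at
Hamming distance `> k` from `c` (and is arbitrary on the ball of radius `k` around `c`).
[cite: GrewalKumar2024, §2.1] -/
def ballGates (k : ℕ) : Set GateFn :=
  {g | ∃ c : Fin g.1 → Bool, ∃ b : Bool, ∀ v : Fin g.1 → Bool,
      k < (univ.filter fun i => v i ≠ c i).card → g.2 v = b}

/-- Unfolding `ballGates`. [cite: GrewalKumar2024, §2.1] -/
theorem mem_ballGates_iff {k : ℕ} {g : GateFn} :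
    g ∈ ballGates k ↔ ∃ c : Fin g.1 → Bool, ∃ b : Bool, ∀ v : Fin g.1 → Bool,
      k < (univ.filter fun i => v i ≠ c i).card → g.2 v = b :=
  Iff.rfl

/-- `G(k) ⊆ G(k')` for `k ≤ k'`. [cite: GrewalKumar2024, §2.1] -/
theorem ballGates_mono {k k' : ℕ} (h : k ≤ k') : ballGates k ⊆ ballGates k' := by
  rintro g ⟨c, b, hg⟩
  exact ⟨c, b, fun v hv => hg v (lt_of_le_of_lt h hv)⟩

/-- Every gate of fan-in `≤ k` is a `G(k)` gate (the ball of radius `k` is everything).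
[cite: GrewalKumar2024, §2.1] -/
theorem mem_ballGates_of_fst_le {k : ℕ} {g : GateFn} (h : g.1 ≤ k) : g ∈ ballGates k := by
  refine ⟨fun _ => false, false, fun v hv => ?_⟩
  exfalso
  have hle : (univ.filter fun i : Fin g.1 => v i ≠ (fun _ : Fin g.1 => false) i).card ≤ g.1 :=
    (card_filter_le _ _).trans (by simp)
  omega

/-- `∧ₘ` is a `G(0)` gate (centre all-true, constant `false` outside), hence a `G(k)` gate.
[cite: GrewalKumar2024, §2.1] -/
theorem and_mem_ballGates (k m : ℕ) : GateFn.and m ∈ ballGates k := by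
  refine ballGates_mono (Nat.zero_le k) ⟨fun _ => true, false, fun v hv => ?_⟩
  simp only [GateFn.and, decide_eq_false_iff_not, not_forall]
  obtain ⟨i, hi⟩ := card_pos.mp hv
  exact ⟨i, by simpa using (mem_filter.mp hi).2⟩

/-- `∨ₘ` is a `G(0)` gate (centre all-false, constant `true` outside), hence a `G(k)` gate.
[cite: GrewalKumar2024, §2.1] -/
theorem or_mem_ballGates (k m : ℕ) : GateFn.or m ∈ ballGates k := by
  refine ballGates_mono (Nat.zero_le k) ⟨fun _ => false, true, fun v hv => ?_⟩
  simp only [GateFn.or, decide_eq_true_eq]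
  obtain ⟨i, hi⟩ := card_pos.mp hv
  exact ⟨i, by simpa using (mem_filter.mp hi).2⟩

/-- `¬` is a `G(0)` gate (centre `true`, constant `true` outside), hence a `G(k)` gate.
[cite: GrewalKumar2024, §2.1] -/
theorem not_mem_ballGates (k : ℕ) : GateFn.not ∈ ballGates k := by
  refine ballGates_mono (Nat.zero_le k) ?_
  show (⟨1, fun v => !(v 0)⟩ : GateFn) ∈ ballGates 0
  refine ⟨fun _ => true, true, fun v hv => ?_⟩
  obtain ⟨i, hi⟩ := card_pos.mp hv
  have hi0 : i = 0 := Subsingleton.elim i 0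
  rw [hi0] at hi
  have hv0 : v 0 = false := by simpa using (mem_filter.mp hi).2
  show (!(v 0)) = true
  rw [hv0]
  rfl

/-- The constant gates are `G(0)` gates. [cite: GrewalKumar2024, §2.1] -/
theorem const_mem_ballGates (k : ℕ) (b : Bool) : GateFn.const b ∈ ballGates k :=
  mem_ballGates_of_fst_le (Nat.zero_le k)

/-! ### The basis of `GC⁰(k)[p]` -/

/-- **The basis of `GC⁰(k)[p]`** (Grewal–Kumar 2024 §2.1: "`GC⁰(k)[p]`" = constant-depth
circuits of `G(k)` gates and `MOD_p` gates): negation, `MOD_{p,m}` of every arity `m`, and all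
`G(k)` gates. [cite: GrewalKumar2024, §2.1] -/
def gcBasis (k p : ℕ) : Set GateFn :=
  ({GateFn.not} ∪ ⋃ m : ℕ, {GateFn.modGate p m}) ∪ ballGates k

/-- `G(k)` gates are in the basis. [cite: GrewalKumar2024, §2.1] -/
theorem ballGates_subset_gcBasis (k p : ℕ) : ballGates k ⊆ gcBasis k p :=
  Set.subset_union_right

/-- `MOD_{p,m}` is in the basis. [cite: GrewalKumar2024, §2.1] -/
theorem modGate_mem_gcBasis (k p m : ℕ) : GateFn.modGate p m ∈ gcBasis k p :=
  Or.inl (Or.inr (Set.mem_iUnion.2 ⟨m, rfl⟩))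

/-- `¬` is in the basis. [cite: GrewalKumar2024, §2.1] -/
theorem not_mem_gcBasis (k p : ℕ) : GateFn.not ∈ gcBasis k p := Or.inl (Or.inl rfl)

/-- The basis grows with `k`. [cite: GrewalKumar2024, §2.1] -/
theorem gcBasis_mono {k k' : ℕ} (h : k ≤ k') (p : ℕ) : gcBasis k p ⊆ gcBasis k' p :=
  Set.union_subset_union le_rfl (ballGates_mono h)

/-- `{¬, ∧ₘ, ∨ₘ, MOD_{p,m}} ⊆ gcBasis k p`: `AC⁰[p]` circuits are `GC⁰(k)[p]` circuits.
[cite: GrewalKumar2024, §2.1] -/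
theorem accBasis_subset_gcBasis (k p : ℕ) : accBasis p ⊆ gcBasis k p := by
  intro g hg
  simp only [accBasis, acBasis, Set.mem_union, Set.mem_iUnion, Set.mem_singleton_iff,
    Set.mem_insert_iff] at hg
  rcases hg with (rfl | ⟨m, (rfl | rfl)⟩) | ⟨m, rfl⟩
  · exact not_mem_gcBasis k p
  · exact ballGates_subset_gcBasis k p (and_mem_ballGates k m)
  · exact ballGates_subset_gcBasis k p (or_mem_ballGates k m)
  · exact modGate_mem_gcBasis k p m

/-- `{¬, ∧ₘ, ∨ₘ} ⊆ gcBasis k p`. [cite: GrewalKumar2024, §2.1] -/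
theorem acBasis_subset_gcBasis (k p : ℕ) : acBasis ⊆ gcBasis k p :=
  (acBasis_subset_accBasis p).trans (accBasis_subset_gcBasis k p)

/-- Case analysis on the basis: a gate function of `gcBasis k p` is `¬`, some `MOD_{p,m}`, or a
`G(k)` gate. [cite: GrewalKumar2024, §2.1] -/
theorem mem_gcBasis_iff {k p : ℕ} {g : GateFn} :
    g ∈ gcBasis k p ↔ g = GateFn.not ∨ (∃ m, g = GateFn.modGate p m) ∨ g ∈ ballGates k := by
  simp only [gcBasis, Set.mem_union, Set.mem_singleton_iff, Set.mem_iUnion, or_assoc]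

end Literature.Computability.Complexity
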